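import Mathlib
import HarnessLib
import Summits.HubbardSuperconductivity.HubbardSuperconductivity.Theorems.KLProgrammeCooperVertexBlocksDefs
import Summits.HubbardSuperconductivity.HubbardSuperconductivity.Theorems.KLProgrammeCooperChannelRiccatiFlowCascade

/-!
# Route `KLProgramme` — D2 companion: the `D₄` blocks are blocks, and C2 applies to the model's Cooper operator
# (cell gate-hubbard-kl, seat p3; DECOMP v7 §8(h) 3, App. E Lemma E.4)

Theorems validating the vocabulary of `KLProgrammeCooperVertexBlocksDefs.lean`:

§1 generic (`ρ : D₄ → (E →L[ℂ] E)` on a complex inner-product space):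
* `isotypicProj_comm`, `mapsTo_channelSubspace_of_comm` — an operator commuting with the action commutes with every
  isotypic projection and leaves every channel subspace invariant (so `blockOp` is available for it);
* `formInf_blockOp` / `formSup_blockOp` — **`formInf (blockOp ρ χ A _) = channelFormInf ρ A χ`** and the same for the
  top: the channel bottoms / tops of the Defs file ARE the `formInf` / `formSup` of
  `KLProgrammeCooperChannelRiccatiFlowDefs.lean` for the block, so files I–VI of C2 apply to them verbatim;
* `blockOp_isSymmetric`, `norm_blockOp_le`, `blockOp_neg/_add/_smul/_mul` — the block of a symmetric operator is
  symmetric, `‖A|_{E_χ}‖ ≤ ‖A‖`, and taking blocks is linear and multiplicative (the block of a flow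
  `V' = V R + P` is the flow of the blocks).

§2 finite volume (`EuclideanSpace ℂ (TorusSite 2 L)`):
* `d4PermRep_apply`, `d4PermRep_one`, `d4PermRep_mul` — `(ρ_g v)(k⃗) = v(g⁻¹ k⃗)` is a representation;
* `cooperOp_apply`, **`cooperOp_comm`** — a Cooper matrix with `A(γk⃗, γk⃗') = A(k⃗, k⃗')` gives an operator commuting
  with the representation; instance **`cooperOp_hubbardEffectiveActionCT_comm`** for the countertermed effective
  action at every scale (from the tree's `cooperMatrix_hubbardEffectiveActionCT_d4Site`);
* **`klScaleBlockInf_eq_formInf`** / `klScaleBlockSup_eq_formSup` — the scale-`Λ` Cooper channel bottoms / tops of the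
  KL programme at finite `(β, L, M)` are `formInf` / `formSup` of a bounded operator on the channel space: the
  objects DECOMP App. E Lemma E.4 runs C2's block flow on exist in the tree, for every irrep, scale and volume.

References: HOME/DECOMP.md v7 §2 C2, §8(h) 3, App. E; D. J. Scalapino, Phys. Rep. 250 (1995) 329, §2.
-/

noncomputable section

namespace Summit.HubbardSuperconductivity.HubbardSuperconductivity.Theorems.CooperVertexBlocks

set_option linter.dupNamespace false -- summit = problem name (single-conjunct summit), D-0017

open scoped InnerProductSpace
open RCLike Literature.MathematicalPhysics.QuantumLattice Literature.Probability.LatticeModels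
open Summit.HubbardSuperconductivity.HubbardSuperconductivity.Theorems.CooperChannelRiccatiFlow

/-! ## §1 Generic layer -/

section Generic

variable {E : Type*} [NormedAddCommGroup E] [InnerProductSpace ℂ E] {ρ : DihedralGroup 4 → E →L[ℂ] E}
  {χ : D4Irrep}

/-- Membership in the channel subspace is the fixed-point equation of the isotypic projection. -/
theorem mem_channelSubspace {v : E} : v ∈ channelSubspace ρ χ ↔ isotypicProj ρ χ v = v := Iff.rfl

/-- **An operator commuting with the `D₄`-action commutes with every isotypic projection.** -/
theorem isotypicProj_comm {A : E →L[ℂ] E} (hA : ∀ g, A * ρ g = ρ g * A) (χ : D4Irrep) :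
    A * isotypicProj ρ χ = isotypicProj ρ χ * A := by
  simp only [isotypicProj, mul_smul_comm, smul_mul_assoc, Finset.mul_sum, Finset.sum_mul, hA]

/-- **An operator commuting with the `D₄`-action leaves every channel subspace invariant** (the hypothesis `hA` of
`blockOp`). -/
theorem mapsTo_channelSubspace_of_comm {A : E →L[ℂ] E} (hA : ∀ g, A * ρ g = ρ g * A) :
    ∀ v ∈ channelSubspace ρ χ, A v ∈ channelSubspace ρ χ := by
  intro v hv
  rw [mem_channelSubspace] at hv ⊢
  have h : A (isotypicProj ρ χ v) = isotypicProj ρ χ (A v) :=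
    congrArg (fun S : E →L[ℂ] E => S v) (isotypicProj_comm hA χ)
  rw [hv] at h
  exact h.symm

/-- The block acts as `A`: `(A|_{E_χ} v : E) = A v`. -/
theorem coe_blockOp_apply (A : E →L[ℂ] E) (hA : ∀ v ∈ channelSubspace ρ χ, A v ∈ channelSubspace ρ χ) (v : channelSubspace ρ χ) : ((blockOp ρ χ A hA v : channelSubspace ρ χ) : E) = A v :=
  rfl

/-- Matrix elements of the block are those of `A`: `⟪v, A|_{E_χ} w⟫ = ⟪v, A w⟫`. -/
theorem inner_blockOp (A : E →L[ℂ] E) (hA : ∀ v ∈ channelSubspace ρ χ, A v ∈ channelSubspace ρ χ) (v w : channelSubspace ρ χ) : ⟪v, blockOp ρ χ A hA w⟫_ℂ = ⟪(v : E), A w⟫_ℂ := by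
  rw [Submodule.coe_inner]
  rfl

/-- **The channel bottom is the bottom of the block:** `formInf (A|_{E_χ}) = channelFormInf ρ A χ`. -/
theorem formInf_blockOp (A : E →L[ℂ] E) (hA : ∀ v ∈ channelSubspace ρ χ, A v ∈ channelSubspace ρ χ) :
    formInf (blockOp ρ χ A hA) = channelFormInf ρ A χ := by
  rw [formInf, channelFormInf]
  congr 1
  ext r
  simp only [Set.mem_image, Set.mem_setOf_eq]
  constructor
  · rintro ⟨v, hv, rfl⟩
    exact ⟨(v : E), ⟨hv, mem_channelSubspace.mp v.2⟩, by rw [inner_blockOp]⟩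
  · rintro ⟨v, ⟨hv1, hv2⟩, rfl⟩
    exact ⟨⟨v, mem_channelSubspace.mpr hv2⟩, hv1, by rw [inner_blockOp]⟩

/-- `-A` leaves the channel invariant when `A` does. -/
theorem mapsTo_neg (A : E →L[ℂ] E) (hA : ∀ v ∈ channelSubspace ρ χ, A v ∈ channelSubspace ρ χ) :
    ∀ v ∈ channelSubspace ρ χ, (-A) v ∈ channelSubspace ρ χ :=
  fun v hv => by simpa using Submodule.neg_mem _ (hA v hv)

/-- The block of `-A` is minus the block of `A`. -/
theorem blockOp_neg (A : E →L[ℂ] E) (hA : ∀ v ∈ channelSubspace ρ χ, A v ∈ channelSubspace ρ χ) :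
    blockOp ρ χ (-A) (mapsTo_neg A hA) = -blockOp ρ χ A hA := by
  apply ContinuousLinearMap.ext
  intro v
  apply Subtype.ext
  rfl

/-- **The channel top is the top of the block:** `formSup (A|_{E_χ}) = channelFormSup ρ A χ`. -/
theorem formSup_blockOp (A : E →L[ℂ] E) (hA : ∀ v ∈ channelSubspace ρ χ, A v ∈ channelSubspace ρ χ) :
    formSup (blockOp ρ χ A hA) = channelFormSup ρ A χ := by
  rw [formSup, channelFormSup, ← blockOp_neg A hA, formInf_blockOp]

/-- **The block of a symmetric operator is symmetric** (so `formInf_cascade`, `blockFlow_envelopes`, … apply). -/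
theorem blockOp_isSymmetric (A : E →L[ℂ] E) (hA : ∀ v ∈ channelSubspace ρ χ, A v ∈ channelSubspace ρ χ)
    (hsym : (A : E →ₗ[ℂ] E).IsSymmetric) :
    ((blockOp ρ χ A hA : channelSubspace ρ χ →L[ℂ] channelSubspace ρ χ) :
      channelSubspace ρ χ →ₗ[ℂ] channelSubspace ρ χ).IsSymmetric := by
  intro v w
  show ⟪blockOp ρ χ A hA v, w⟫_ℂ = ⟪v, blockOp ρ χ A hA w⟫_ℂ
  rw [Submodule.coe_inner, Submodule.coe_inner, coe_blockOp_apply, coe_blockOp_apply]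
  exact hsym.apply_clm (v : E) (w : E)

/-- `‖A|_{E_χ}‖ ≤ ‖A‖`. -/
theorem norm_blockOp_le (A : E →L[ℂ] E) (hA : ∀ v ∈ channelSubspace ρ χ, A v ∈ channelSubspace ρ χ) :
    ‖blockOp ρ χ A hA‖ ≤ ‖A‖ := by
  refine ContinuousLinearMap.opNorm_le_bound _ (norm_nonneg _) fun v => ?_
  change ‖A (v : E)‖ ≤ ‖A‖ * ‖(v : E)‖
  exact A.le_opNorm _

/-- `A + B` leaves the channel invariant when `A`, `B` do. -/
theorem mapsTo_add (A : E →L[ℂ] E) (hA : ∀ v ∈ channelSubspace ρ χ, A v ∈ channelSubspace ρ χ)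
    (B : E →L[ℂ] E) (hB : ∀ v ∈ channelSubspace ρ χ, B v ∈ channelSubspace ρ χ) :
    ∀ v ∈ channelSubspace ρ χ, (A + B) v ∈ channelSubspace ρ χ :=
  fun v hv => Submodule.add_mem _ (hA v hv) (hB v hv)

/-- `A B` leaves the channel invariant when `A`, `B` do. -/
theorem mapsTo_mul (A : E →L[ℂ] E) (hA : ∀ v ∈ channelSubspace ρ χ, A v ∈ channelSubspace ρ χ)
    (B : E →L[ℂ] E) (hB : ∀ v ∈ channelSubspace ρ χ, B v ∈ channelSubspace ρ χ) :
    ∀ v ∈ channelSubspace ρ χ, (A * B) v ∈ channelSubspace ρ χ :=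
  fun v hv => hA _ (hB v hv)

/-- `c • A` leaves the channel invariant when `A` does. -/
theorem mapsTo_smul (A : E →L[ℂ] E) (hA : ∀ v ∈ channelSubspace ρ χ, A v ∈ channelSubspace ρ χ) (c : ℝ) :
    ∀ v ∈ channelSubspace ρ χ, (c • A) v ∈ channelSubspace ρ χ :=
  fun v hv => by
    change c • A v ∈ channelSubspace ρ χ
    exact Submodule.smul_of_tower_mem _ c (hA v hv)

/-- The identity leaves every channel invariant. -/
theorem mapsTo_one : ∀ v ∈ channelSubspace ρ χ, (1 : E →L[ℂ] E) v ∈ channelSubspace ρ χ := fun _ hv => hv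

/-- **Blocks add:** `(A + B)|_{E_χ} = A|_{E_χ} + B|_{E_χ}`. -/
theorem blockOp_add (A : E →L[ℂ] E) (hA : ∀ v ∈ channelSubspace ρ χ, A v ∈ channelSubspace ρ χ)
    (B : E →L[ℂ] E) (hB : ∀ v ∈ channelSubspace ρ χ, B v ∈ channelSubspace ρ χ) :
    blockOp ρ χ (A + B) (mapsTo_add A hA B hB) = blockOp ρ χ A hA + blockOp ρ χ B hB := by
  apply ContinuousLinearMap.ext
  intro v
  apply Subtype.ext
  rfl

/-- **Blocks multiply:** `(A B)|_{E_χ} = A|_{E_χ} B|_{E_χ}` — the block of a ladder step `V (1 + b V)⁻¹` is the ladder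
step of the block. -/
theorem blockOp_mul (A : E →L[ℂ] E) (hA : ∀ v ∈ channelSubspace ρ χ, A v ∈ channelSubspace ρ χ)
    (B : E →L[ℂ] E) (hB : ∀ v ∈ channelSubspace ρ χ, B v ∈ channelSubspace ρ χ) :
    blockOp ρ χ (A * B) (mapsTo_mul A hA B hB) = blockOp ρ χ A hA * blockOp ρ χ B hB := by
  apply ContinuousLinearMap.ext
  intro v
  apply Subtype.ext
  rfl

/-- Blocks commute with real scalars: `(c • A)|_{E_χ} = c • A|_{E_χ}`. -/
theorem blockOp_smul (A : E →L[ℂ] E) (hA : ∀ v ∈ channelSubspace ρ χ, A v ∈ channelSubspace ρ χ) (c : ℝ) :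
    blockOp ρ χ (c • A) (mapsTo_smul A hA c) = c • blockOp ρ χ A hA := by
  apply ContinuousLinearMap.ext
  intro v
  apply Subtype.ext
  rfl

/-- The block of the identity is the identity. -/
theorem blockOp_one : blockOp ρ χ (1 : E →L[ℂ] E) mapsTo_one = 1 := by
  apply ContinuousLinearMap.ext
  intro v
  apply Subtype.ext
  rfl

/-- **The block of a two-sided inverse of `1 + b V` is a two-sided inverse of `1 + b V|_{E_χ}`** — the inverse
equations of C2's cascade theorems transfer to the blocks. -/
theorem blockOp_inverse {V R : E →L[ℂ] E} {b : ℝ} (hV : ∀ v ∈ channelSubspace ρ χ, V v ∈ channelSubspace ρ χ)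
    (hR : ∀ v ∈ channelSubspace ρ χ, R v ∈ channelSubspace ρ χ) (h₁ : (1 + b • V) * R = 1)
    (h₂ : R * (1 + b • V) = 1) :
    (1 + b • blockOp ρ χ V hV) * blockOp ρ χ R hR = 1 ∧ blockOp ρ χ R hR * (1 + b • blockOp ρ χ V hV) = 1 := by
  constructor
  · apply ContinuousLinearMap.ext
    intro v
    apply Subtype.ext
    have h := congrArg (fun S : E →L[ℂ] E => S (v : E)) h₁
    exact h
  · apply ContinuousLinearMap.ext
    intro v
    apply Subtype.ext
    have h := congrArg (fun S : E →L[ℂ] E => S (v : E)) h₂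
    exact h

end Generic

/-! ## §2 Finite volume -/

section FiniteVolume

variable (L M : ℕ) [NeZero L]

/-- `(ρ_g v)(k⃗) = v(g⁻¹ k⃗)`. -/
theorem d4PermRep_apply (g : DihedralGroup 4) (v : EuclideanSpace ℂ (TorusSite 2 L)) (k : TorusSite 2 L) :
    d4PermRep L g v k = v (d4Site g⁻¹ k) := by
  simp [d4PermRep, LinearIsometryEquiv.piLpCongrLeft_apply, Equiv.piCongrLeft'_apply, d4SitePerm_symm_apply]

/-- `ρ_1 = 1`. -/
theorem d4PermRep_one : d4PermRep L 1 = 1 := by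
  apply ContinuousLinearMap.ext
  intro v
  ext k
  rw [d4PermRep_apply, inv_one, d4Site_one]
  rfl

/-- `ρ_{gh} = ρ_g ρ_h`: the permutation action is a representation. -/
theorem d4PermRep_mul (g h : DihedralGroup 4) : d4PermRep L (g * h) = d4PermRep L g * d4PermRep L h := by
  apply ContinuousLinearMap.ext
  intro v
  ext k
  change d4PermRep L (g * h) v k = d4PermRep L g (d4PermRep L h v) k
  rw [d4PermRep_apply, d4PermRep_apply, d4PermRep_apply, mul_inv_rev, d4Site_mul_holds]

/-- Each `ρ_g` is an isometry. -/
theorem norm_d4PermRep_apply (g : DihedralGroup 4) (v : EuclideanSpace ℂ (TorusSite 2 L)) :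
    ‖d4PermRep L g v‖ = ‖v‖ :=
  (LinearIsometryEquiv.piLpCongrLeft 2 ℂ ℂ (d4SitePerm (L := L) g)).norm_map v

variable [NeZero M]

/-- The Cooper operator acts by the Cooper matrix: `(cooperOp v)(k⃗) = Σ_{k⃗'} A(k⃗, k⃗') v(k⃗')`. -/
theorem cooperOp_apply (β : ℝ) (e : TorusSite 2 L → ℝ) (Λ : ℝ) (G : HubbardGrassmann L M)
    (v : EuclideanSpace ℂ (TorusSite 2 L)) (k : TorusSite 2 L) :
    cooperOp L M β e Λ G v k = ∑ k', cooperMatrix L M β e Λ G k k' * v k' := by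
  rfl

/-- **A `D₄`-covariant Cooper matrix gives an operator commuting with the representation**:
`A(γk⃗, γk⃗') = A(k⃗, k⃗')` for all `γ` ⇒ `cooperOp ρ_g = ρ_g cooperOp` for all `g`. -/
theorem cooperOp_comm {β : ℝ} {e : TorusSite 2 L → ℝ} {Λ : ℝ} {G : HubbardGrassmann L M}
    (hcov : ∀ (γ : DihedralGroup 4) (k k' : TorusSite 2 L),
      cooperMatrix L M β e Λ G (d4Site γ k) (d4Site γ k') = cooperMatrix L M β e Λ G k k') (g : DihedralGroup 4) :
    cooperOp L M β e Λ G * d4PermRep L g = d4PermRep L g * cooperOp L M β e Λ G := by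
  apply ContinuousLinearMap.ext
  intro v
  ext k
  change cooperOp L M β e Λ G (d4PermRep L g v) k = d4PermRep L g (cooperOp L M β e Λ G v) k
  rw [cooperOp_apply, d4PermRep_apply, cooperOp_apply]
  simp_rw [d4PermRep_apply]
  -- reindex the first sum by `k' = g j`
  rw [← Equiv.sum_comp (d4SitePerm (L := L) g) (fun k' => cooperMatrix L M β e Λ G k k' * v (d4Site g⁻¹ k'))]
  refine Finset.sum_congr rfl fun j _ => ?_
  rw [d4SitePerm_apply, d4Site_inv_apply]
  congr 1
  conv_lhs => rw [← d4Site_apply_inv g k]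
  exact hcov g (d4Site g⁻¹ k) j

/-- **The Cooper operator of the countertermed effective action commutes with `D₄`** at every scale `Λ`, frame `K`,
`(β, U, μ)` (seed `0`, band `e_K`). -/
theorem cooperOp_hubbardEffectiveActionCT_comm (β U μ : ℝ) (K : TrigPolyC4v) (Λ : ℝ) (g : DihedralGroup 4) :
    cooperOp L M β (nambuXiCT L μ K) Λ (hubbardEffectiveActionCT L M β U μ 0 K Λ) * d4PermRep L g =
      d4PermRep L g * cooperOp L M β (nambuXiCT L μ K) Λ (hubbardEffectiveActionCT L M β U μ 0 K Λ) :=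
  cooperOp_comm L M (fun γ k k' => cooperMatrix_hubbardEffectiveActionCT_d4Site L M β U μ Λ K γ k k') g

/-- The scale-`Λ` Cooper operator of the KL programme leaves every channel subspace invariant. -/
theorem klScale_mapsTo (β U μ : ℝ) (K : TrigPolyC4v) (Λ : ℝ) (χ : D4Irrep) :
    ∀ v ∈ channelSubspace (d4PermRep L) χ,
      cooperOp L M β (nambuXiCT L μ K) Λ (hubbardEffectiveActionCT L M β U μ 0 K Λ) v ∈
        channelSubspace (d4PermRep L) χ :=
  mapsTo_channelSubspace_of_comm (cooperOp_hubbardEffectiveActionCT_comm L M β U μ K Λ)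

/-- **C2 applies to the model's blocks, bottom:** the scale-`Λ` Cooper channel bottom of the KL programme at finite
`(β, L, M)` is `formInf` of the block operator on the channel space. -/
theorem klScaleBlockInf_eq_formInf (β U μ : ℝ) (K : TrigPolyC4v) (Λ : ℝ) (χ : D4Irrep) :
    klScaleBlockInf L M β U μ K Λ χ =
      formInf (blockOp (d4PermRep L) χ
        (cooperOp L M β (nambuXiCT L μ K) Λ (hubbardEffectiveActionCT L M β U μ 0 K Λ))
        (klScale_mapsTo L M β U μ K Λ χ)) :=
  (formInf_blockOp _ _).symm

/-- **C2 applies to the model's blocks, top:** the scale-`Λ` Cooper channel top is `formSup` of the block operator. -/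
theorem klScaleBlockSup_eq_formSup (β U μ : ℝ) (K : TrigPolyC4v) (Λ : ℝ) (χ : D4Irrep) :
    klScaleBlockSup L M β U μ K Λ χ =
      formSup (blockOp (d4PermRep L) χ
        (cooperOp L M β (nambuXiCT L μ K) Λ (hubbardEffectiveActionCT L M β U μ 0 K Λ))
        (klScale_mapsTo L M β U μ K Λ χ)) :=
  (formSup_blockOp _ _).symm

end FiniteVolume

end Summit.HubbardSuperconductivity.HubbardSuperconductivity.Theorems.CooperVertexBlocks

end
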